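/-
COR-CM (cells pub-hodgecm / pub-hodgecm2, stage 2 of the Hodge ladder) — TRANSPOSITION SURGE, item (vi) sub-binder S2 / (vi-2)
`supply`, PINNING BUILDER 2 of 3 (coordinator ruling «HODGE FINISH-TODAY SWARM» 2026-08-21T16:13:55Z (2); pub-hodgecm2 lead
NAMING RULING 16:14:26Z (2): writer pin-2 = prover-pub-hodgecm2-pin-2-0, path `CorCM/B01/Transposition/Item6PinMatch.lean`).
The `hMatch` / `hCM` half of own-htheta's PINNED as-printed junction `Model.faceSupply_of_thm418AsPrinted_pinned`
(`Transposition/Item6SupplyPinned.lean`, own-htheta g3, FROZEN — not imported, not edited, not restated: its binder TYPES are met on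
the nose), AT LIU'S OWN OBJECTS `M := M_μ`, `e := (M'_μ ⊆ M_μ)`, `Aμ := A_{(M_μ, Ψ̃_μ)}` (binder-1 g22's CM-side lane, by name where
landed).  Imports tree modules + item6-p3's `Thm418Invariants` only.  Theorems only: no definition, no instance, no named fact,
nothing asserted, no proof holes.  FRAMING: HC_CM is NOT proved.
-/
import Literature.NumberTheory.Automorphic.Liu2021.Thm418Invariants
import Literature.NumberTheory.Automorphic.IdeleClassCharacterValueFieldCM
import Literature.AlgebraicGeometry.Motives.AbelianVarietyProjective
import Summits.HodgeConjecture.CorCM.B01.Transposition.Item6SupplyReach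
import Summits.HodgeConjecture.CorCM.CMSideReachOfInverseType
import HarnessLib

/-!
# Item (vi) S2 at the pinned datum — the CM side (`hMatch` ∕ `hCM`) AT THE LIU PIN, token by token

Own-htheta's junction `Model.faceSupply_of_thm418AsPrinted_pinned (D) (Aμ) (hLiu) (hObj) (hChi) (hirr) (hsm) (hμ) (hCM)
(hReach) : U.FaceSupply` derives B01-S from [Liu 2021, Thm. 4.18] EXACTLY AS PRINTED (`Liu2021.Thm418AsPrinted (D …)`) for the
consumer's datum `D F ι₁ V Φ : Thm418Data F⁺ F` and a consumer's pin `Aμ F ι₁ V Φ D_μ : AbelianVariety ℂ` (intended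
`A_μ ⊗_{E,ι₁} ℂ`), with the CM side of the object match as the binder

  `hCM` — «`Aμ … D_μ` realises, over SOME CM number field `M` receiving the reflex field `K*` of `(F, Φ_μ)` along SOME
  `e : K* → M`, the CM type induced along `e` from the reflex pair `(K*, Φ_μ*)`» ([Liu2021] Def. 4.5 (2) with Def. 4.3 (2)).

This file MATCHES the tokens of that sentence with Liu's printed objects, all of which are REAL tree objects for the datum's own
character `μ = (D …).μ : C_F →ₜ* S¹` (conjugate symplectic of weight one, `Thm418Data.isConjugateSymplectic` / `.hasWeight_one`):

| token of `hCM` | Liu's object, AS PRINTED (`FJcycle.tex` md5 6db49a74122d) | tree term |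
|---|---|---|
| `M` | `M_μ ⊆ ℂ`, «the subfield generated by values `μ^{alg}(x)` for `x ∈ (𝔸_E^∞)^×`, which is a number field containing `M'_μ`» (§4.1 l. 1928) | `IdeleClassGroup.muAlgValueField F μ` — a CM NUMBER FIELD: `IsConjugateSymplectic.numberField_muAlgValueField`, `.isCMField_muAlgValueField` (binder-1, `Literature/NumberTheory/Automorphic/IdeleClassCharacterValueFieldCM.lean`, p286759); `= (Liu2021.fieldOfValues F μ).toSubfield`, the carrier of `Thm418AsPrinted` (binder-1 bridge `Liu2021.fieldOfValues_toSubfield`) |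
| `K*` | `M'_μ ⊆ ℂ`, «the reflex field of `(E, Φ_μ)`, with the induced CM type `Ψ_μ`» (Def. 4.3 (2), l. 1919) | `reflexField ℚ F (algValuedIn ι₁ Φ_μ) ⊆ F` read in `ℂ` through `ι₁` (`ι₁(K*) = traceField Φ_μ`; `F` Galois); `Φ_μ = Thm418Data.cmType` |
| `e : K* → M` | the inclusion «containing `M'_μ`» (l. 1928) | `e_μ`, `(e_μ k : ℂ) = ι₁ k` (`Model.exists_ringHom_reflexField_muAlgValueField`; unique with this property) |
| the type on `H¹` | `Ψ̃_μ :=` the CM type of `A_μ ⊗_{E,ι₁} ℂ` over `M_μ` = the type induced from `(M'_μ, Ψ_μ)` to `M_μ` — by Def. 4.5 (2) first bullet, l. 1947–1949: «`i_μ : M_μ → End_E(A_μ)_ℚ` is a CM structure such that for every `x ∈ M_μ`, the determinant of the action of `i_μ(x)` on the `E`-vector space `Lie_E(A_μ)` equals `η_μ(x)`», `η_μ := η'_μ ∘ Nm_{M_μ/M'_μ}` (Def. 4.5 (1), l. 1939–1942) (tree reading of exactly this bullet: `Liu2021.LiuCMData.cmType_eq_induced_of_det45`) | `inducedCMType e_μ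 (reflexCMType ι₁ Φ_μ (AlgHom.id ℚ F))` |
| `Aμ … D_μ` | «`A_μ` is an abelian variety over `E`» with that CM structure (Def. 4.5 (2), l. 1944–1951), base-changed along `ι₁` | **THE LIU PIN** `A_{(M_μ, Ψ̃_μ)} := (cmRealisation h₃ (cmCode ⟨M_μ⟩ Ψ̃_μ)).AV`, the tree's own complex CM abelian variety of type `(M_μ, Ψ̃_μ)` (`CMAbelianVarietyRealised`, Shimura 1998 §6.2 Thm. 3) — Liu's `A_μ ⊗_{E,ι₁} ℂ` UP TO ISOGENY (two complex abelian varieties with CM by `M_μ` of the same type and dimension `[M_μ:ℚ]/2` are isogenous, Shimura 1998 §6.1 Cor. of Thm. 2) |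
| `ιB`, `θB`, realisation | the CM structure `i_μ` on `A_μ` and its action on `H¹_B(A_μ ⊗_{E,ι₁} ℂ)` (proof of Thm. 4.18, l. 2250) | the realisation data of `cmRealisation h₃ (cmCode ⟨M_μ⟩ Ψ̃_μ)`: `Model.isCMTypeRealisation_cmCode_read` (binder-1 g21, p283674) |

Consequences, as KERNEL THEOREMS (nothing posited on the CM side):
* §1 `Model.hCM_pinned_at_liuPin` — own-htheta's EXACT `∃`-shape of `hCM`, for ONE datum, is INHABITED at the Liu pin (`M := M_μ`,
  `e := e_μ`, realisation data of the tree's `A_{(M_μ, Ψ̃_μ)}`; = binder-1's `Model.exists_liuPin_isCMTypeRealisation`).  The token match.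
* §2 `Model.faceSupply_of_thm418AsPrinted_liuPin (D) (hLiu) (hObj) (hChi) (hirr) (hsm) (hμ) (hReachμ) : U.FaceSupply` — the pinned
  junction AT THE LIU PIN: `Aμ` is the Liu pin, `hCM` is GONE, and the one Shimura-side binder `hReachμ` is own-htheta's `hReach`
  stated at `A_{(M_μ, Ψ̃_μ)}` (the inclusion `e_μ` quantified with its defining property `(e k : ℂ) = ι₁ k`, which determines it; no
  definition introduced — binder-1's `CorCM/LiuPinFamily.lean` is the turnkey `def` form).  Documented ALTERNATIVE to the pin of record.
* §3 `Model.hCM_of_hCMμ` / `Model.hCM_of_hCMμ_baseChange` — BRIDGES for the assembler (pin-3): the `M_μ`-sharpened family `hCMμ`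
  (`M := M_μ`, `e := e_μ`; only the realisation data `(ιB, θB)` of Def. 4.5 (2) posited) ⟹ own-htheta's `hCM` family, at any pin and
  at the `E`-RATIONAL PIN OF RECORD `Aμ … D_μ := (Aμ₀ … D_μ).baseChange ℂ` along `ι₁.toAlgebra`, `Aμ₀ … D_μ : AbelianVariety F` = Liu's
  «`A_μ` is an abelian variety over `E`» (pin-3 INTERFACE v0 §2 target type, on the nose).
* §4 `Model.faceSupply_of_thm418AsPrinted_pinned_isog` — the junction at a consumer's pin with the CM side read UP TO ISOGENY
  (`hCMisog`: `Aμ … D_μ` is isogenous to an `𝓞_{M_μ}`-realisation of `Ψ̃_μ`) — Def. 4.5 (2)'s RATIONAL CM structure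
  `i_μ : M_μ → End_E(A_μ)_ℚ` exactly as printed, true for every object of `𝒜(μ)` (the integral form `hCM`/`hCMμ` holds for objects
  with `𝓞_{M_μ}`-stable lattice only); composed directly (item6-p3 / item6-p1 / binder-1 tree theorems).  JUNCTION OF RECORD of the
  assembly (pin-3 `Item6SupplyPinnedAssembly.lean`, `…_pinnedE_isog`).

READING / STRENGTH (for the red team and the T5 seat; kernel content unchanged — own-htheta's certificate
`Item6SupplyPinnedCertificate.lean`: every closing binder family is, given the Liu-side binders, ⟺ B01-S; each junction here ⟹ B01-S,
no ↔ claimed at a fixed pin).  The two pins trade places: Liu pin ⟹ `hCM` is a THEOREM and the identification «`A_μ ⊗_{E,ι₁} ℂ ∼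
A_{(M_μ, Ψ̃_μ)}`» (Def. 4.5 (2) + uniqueness of the isogeny class of a CM type, Shimura 1998 §6.1) moves into the INTENDED READING of
`hReachμ` (whose `HomK K D_μ` stays the `E`-rational carrier `Hom_E(A_K, A_μ)_ℚ` — NOT pinned to complex homomorphisms);
`E`-rational pin ⟹ (U1) «`Hom_E ↪ Hom_ℂ`» is a THEOREM (`AbelianVariety.lTensor_baseChange_ne_zero`, binder-1 p288061) and the CM side
stays the binder `hCMisog` / `hCMμ` — DISCHARGEABLE-BY-KNOWN-RESULT («the CM type over `M_μ` of `A_μ ⊗_{E,ι₁} ℂ` for a REAL `A_μ/E`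
with `i_μ` is `Ψ̃_μ`»: Def. 4.5 (2) first bullet through `Lie_E`, base change and the Hodge decomposition — vocabulary the tree lacks).
Every binder is GUARDED to `IsGalois ℚ F → 6 ≤ [F:ℚ] → ι₁ ∈ Φ` (lead RULING «AS-PRINTED JUNCTION T1»); none depends on `[F:ℚ]` or
on the face beyond the guard; NO printed hypothesis of Thm. 4.18 is unmet on the CM side.  NOT claimed: that Liu's `X_K` / `A_K` /
`A_μ` are constructed; that `hReachμ` / `hReach` (the S2-CRUX (M-Sh), pin-1's object) or `hD` is inhabited; that HC_CM is proved.

References: Y. Liu, *Fourier–Jacobi cycles and arithmetic relative trace formula*, Camb. J. Math. 9 (2021) = arXiv:2102.11518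
(`FJcycle.tex` md5 6db49a74122d): Def. 4.3 (2) l. 1914–1921, §4.1 l. 1924–1928, Def. 4.5 l. 1936–1964, Prop. 4.6 (1) l. 1969, §4.2
l. 2053–2076, Def. 4.11 l. 2083–2097, Thm. 4.18 l. 2232–2245 (proof l. 2247–2252), App. C Prop. C.5 l. 4627–4637; G. Shimura, *Abelian
Varieties with Complex Multiplication and Modular Functions* (1998) §5.2, §6.1, §6.2 Thm. 3, §8.3 Prop. 28; D. Mumford, *Abelian Varieties* §19.
-/

noncomputable section

open scoped TensorProduct InnerProductSpace

namespace Summit.HodgeConjecture.CorCM.Model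

open CategoryTheory AlgebraicGeometry NumberField
open Literature.AlgebraicGeometry.Motives
open Literature.AlgebraicGeometry.HodgeTheory
open Literature.AlgebraicGeometry.ComplexMultiplication (IsCMTypeRealisation)
open Literature.NumberTheory.ComplexMultiplication
open Literature.NumberTheory.Automorphic
open Literature.NumberTheory.Automorphic.IdeleClassGroup
open Literature.NumberTheory.Automorphic.PicardCM
open Literature.NumberTheory.Automorphic.Liu2021

/-! ## §0  Liu's inclusion `M'_μ ⊆ M_μ` at the tree's reflex field (re-derived; = binder-1's `exists_ringHom_reflexField_muAlgValueField`) -/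

section Incl

/-- **The inclusion `e_μ : K* → M_μ`, `k ↦ ι₁(k)`** ([Liu2021] §4.1 l. 1928 «`M_μ` … a number field containing `M'_μ`»; Def. 4.3 (2)
l. 1919), for a conjugate symplectic `ψ = μ` of CM type `Θ` on a Galois CM field `F`: `ι₁(K*) = traceField Θ = M'_μ`
(`ComplexMultiplication.map_reflexField_algValuedIn`) and `traceField Θ ⊆ M_μ` (`IsConjugateSymplectic.traceField_le_muAlgValueField`).
TWIN DISCLOSURE: statement and proof = binder-1 g22's `Model.exists_ringHom_reflexField_muAlgValueField`
(`CorCM/LiuValueFieldPin.lean`, p287244 — pending at filing time); re-derived PRIVATELY here only so that this file imports tree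
modules alone (no new public declaration). [cite: Liu2021, §4.1 (FJcycle.tex l. 1928) and Def. 4.3 (2) (l. 1919)] -/
private theorem exists_liuIncl (F : CMField) [IsGalois ℚ F] (ι₁ : F →+* ℂ) (Θ : CMType F)
    {ψ : IdeleClassGroup F →ₜ* Circle} (hψ : IsConjugateSymplectic F ψ) (hT : HasCMType F ψ Θ) :
    ∃ e : reflexField ℚ F (algValuedIn ι₁ Θ.1) →+* muAlgValueField F ψ,
      ∀ k : reflexField ℚ F (algValuedIn ι₁ Θ.1), ((e k : muAlgValueField F ψ) : ℂ) = ι₁ k := by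
  have hmem : ∀ k : reflexField ℚ F (algValuedIn ι₁ Θ.1), ι₁ k ∈ muAlgValueField F ψ := fun k => by
    have hk : ι₁ k ∈ traceField Θ := by
      rw [← map_reflexField_algValuedIn (AlgHom.id ℚ F) ι₁ Θ, IntermediateField.mem_map]
      exact ⟨k, k.2, rfl⟩
    exact hψ.traceField_le_muAlgValueField hT hk
  exact ⟨(ι₁.comp (reflexField ℚ F (algValuedIn ι₁ Θ.1)).val.toRingHom).codRestrict (muAlgValueField F ψ) hmem,
    fun _ => rfl⟩

end Incl

/-! ## §1  The token match: own-htheta's `hCM` `∃`-shape is inhabited at the Liu pin -/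

section Match

/-- **`hCM` HOLDS AT THE LIU PIN, in own-htheta's exact `∃`-shape** (one face context; `F` Galois CM, `ι₁ : F → ℂ`, one datum
`D : Thm418Data F⁺ F` of [Liu2021, Thm. 4.18] as printed, `μ := D.μ`, `Φ_μ := D.cmType`).  With `M_μ = muAlgValueField F μ`
([Liu2021] §4.1 l. 1928; a CM number field, binder-1 p286759) there is THE inclusion `e_μ : K* → M_μ`, `(e_μ k : ℂ) = ι₁ k`
(`K* = ι₁⁻¹(M'_μ)`, Def. 4.3 (2) l. 1919, «`M_μ` … containing `M'_μ`» l. 1928), and for the Liu pin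
`Aμ := A_{(M_μ, Ψ̃_μ)} = (cmRealisation h₃ (cmCode ⟨M_μ⟩ Ψ̃_μ)).AV`, `Ψ̃_μ = inducedCMType e_μ (reflexCMType ι₁ Φ_μ id)` — Liu's
`A_μ ⊗_{E,ι₁} ℂ` up to isogeny by Def. 4.5 (2) first bullet (l. 1947–1949) — the sentence `∃ (M) (_ : Field M) (_ : NumberField M)
(_ : IsCMField M) (e : K* →+* M) ιB θB, IsCMTypeRealisation (inducedCMType e (reflexCMType ι₁ Φ_μ id)) Aμ ιB θB` is TRUE with
`M := M_μ`, `e := e_μ`, `(ιB, θB) :=` the tree's realisation data (`Model.isCMTypeRealisation_cmCode_read`; packaged by binder-1 as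
`Model.exists_liuPin_isCMTypeRealisation`).  Nothing posited.  HC_CM is NOT proved.
[cite: Liu2021, Def. 4.3 (2) (FJcycle.tex l. 1919), §4.1 l. 1928 and Def. 4.5 (2) (l. 1944–1951)]
[cite: Shimura1998, §6.2 Theorem 3 and §8.3 Prop. 28] -/
theorem hCM_pinned_at_liuPin (h₃ : CMAbelianVarietyRealised) (F : CMField) [IsGalois ℚ F] (ι₁ : F →+* ℂ)
    (D : Thm418Data (maximalRealSubfield F) F) :
    haveI := D.isConjugateSymplectic.numberField_muAlgValueField
    haveI := D.isConjugateSymplectic.isCMField_muAlgValueField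
    ∃ e : reflexField ℚ F (algValuedIn ι₁ D.cmType.1) →+* muAlgValueField F D.μ,
      (∀ k : reflexField ℚ F (algValuedIn ι₁ D.cmType.1), ((e k : muAlgValueField F D.μ) : ℂ) = ι₁ k) ∧
      ∃ (M : Type) (_ : Field M) (_ : NumberField M) (_ : IsCMField M)
        (e' : reflexField ℚ F (algValuedIn ι₁ D.cmType.1) →+* M)
        (ιB : 𝓞 M →+* End (cmRealisation h₃ (cmCode (CMField.mk (muAlgValueField F D.μ))
          (inducedCMType e (reflexCMType ι₁ D.cmType (AlgHom.id ℚ F))))).AV)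
        (θB : M →+* Module.End ℂ (complexBetti (cmRealisation h₃ (cmCode (CMField.mk (muAlgValueField F D.μ))
          (inducedCMType e (reflexCMType ι₁ D.cmType (AlgHom.id ℚ F))))).AV.X 1)),
        IsCMTypeRealisation (inducedCMType e' (reflexCMType ι₁ D.cmType (AlgHom.id ℚ F)))
          (cmRealisation h₃ (cmCode (CMField.mk (muAlgValueField F D.μ))
            (inducedCMType e (reflexCMType ι₁ D.cmType (AlgHom.id ℚ F))))).AV ιB θB := by
  haveI := D.isConjugateSymplectic.numberField_muAlgValueField
  haveI := D.isConjugateSymplectic.isCMField_muAlgValueField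
  obtain ⟨e, he⟩ := exists_liuIncl F ι₁ D.cmType D.isConjugateSymplectic D.isConjugateSymplectic.hasCMType_cmType
  exact ⟨e, he, muAlgValueField F D.μ, inferInstance, inferInstance, inferInstance, e, _, _,
    isCMTypeRealisation_cmCode_read h₃ (CMField.mk (muAlgValueField F D.μ))
      (inducedCMType e (reflexCMType ι₁ D.cmType (AlgHom.id ℚ F)))⟩

end Match

/-! ## §2  The pinned junction AT THE LIU PIN: `hCM` eliminated, `hReach` stated at `A_{(M_μ, Ψ̃_μ)}` -/

section LiuPin

/-- **B01-S from [Liu 2021, Thm. 4.18] AS PRINTED at the LIU PIN** (`U = picardCMUniverse hHD hI h₁ h₃`): own-htheta's pinned junction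
with the pin FIXED to Liu's own CM abelian variety `Aμ … D_μ := A_{(M_μ, Ψ̃_μ)} = (cmRealisation h₃ (cmCode ⟨M_μ⟩ (inducedCMType e_μ
(reflexCMType ι₁ Φ_μ id)))).AV` — `μ := (D …).μ`, `Φ_μ := (D …).cmType`, `M_μ = muAlgValueField F μ` ([Liu2021] §4.1 l. 1928),
`e_μ : K* = ι₁⁻¹(M'_μ) → M_μ` the inclusion (Def. 4.3 (2) l. 1919), `Ψ̃_μ` the type of `A_μ ⊗_{E,ι₁} ℂ` over `M_μ` (Def. 4.5 (2) first
bullet, l. 1947–1949).  Binders (each only for Galois CM `F`, `6 ≤ [F:ℚ]`, `Φ ∋ ι₁`, every `V`) = own-htheta's list VERBATIM with `Aμ` and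
`hCM` GONE and `hReach` stated at the pin: `hLiu` — THE CITE BINDER, Thm. 4.18 exactly as printed (l. 2232–2245); `hObj` — `𝒜(μ) ≠ ∅`
(Prop. 4.6 (1), l. 1969); `hChi` — one character `χ` of `E¹\(𝔸_E^∞)¹` (Def. 4.11, l. 2090); `hirr`, `hsm` — VERBATIM Def. 4.11 l. 2096
«irreducible admissible representation of `𝔾(𝔸_F^∞)`»; `hμ` — the CHOICE `Φ_μ = Φ^{*ι₁}`; and
* `hReachμ` — C0/C6a AT THE LIU PIN: for the inclusion `e = e_μ` (quantified with its defining property `(e k : ℂ) = ι₁ k`, which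
  determines it), below SOME open compact `Ksm` («sufficiently small», §4.2 l. 2060) a non-zero `φ ∈ Hom_E(A_K, A_μ)_ℚ` (the carrier
  `HomK K D_μ`; NOT pinned to complex homomorphisms — E-rationality of Thm. 4.18 (1)) at an open compact `K ≤ Ksm` yields a non-zero
  `Alb(P_Γ(V)) ⟶ A_{(M_μ, Ψ̃_μ)}` on some component of the tree's `V`-tower, for some Albanese datum.  INTENDED READING: §4.2
  l. 2060–2076 (`X_K`, `A_K := Alb X_K`) + App. C Prop. C.5 l. 4627–4633 with (h2) complex uniformisation (Deligne; not printed in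
  [Liu2021]), (h3) Chow/GAGA, (h4) Albanese functoriality, (h5) `Hom_E ↪ Hom_ℂ` (tree: `AbelianVariety.lTensor_baseChange_ne_zero`) AND
  (h6) «`A_μ ⊗_{E,ι₁} ℂ ∼ A_{(M_μ, Ψ̃_μ)}`» (Def. 4.5 (2) + uniqueness of the isogeny class, Shimura 1998 §6.1) — (h6) is where the CM
  bookkeeping of `hCM` now lives, as a reading.  = the S2-CRUX (M-Sh) (pin-1's object) at the target `A_{(M_μ, Ψ̃_μ)}`.
KERNEL: item6-p3 `Thm418Data.exists_homK_ne_zero_of_irreducible_smooth`, `hReachμ`, binder-1 `Model.exists_hom_cmAV_ne_zero_of_reach_cmCode_reflex`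
(Shimura §6 over Riemann + §8.3 Prop. 28; = its `exists_liuPin_reach`), item6-p1 `Model.faceSupply_of_albaneseFactor`.  No degree- or
face-specific input.  HC_CM is NOT proved; `hReachμ` is not inhabited here.
[cite: Liu2021, Thm. 4.18 (FJcycle.tex l. 2232–2245), Def. 4.5 (2) (l. 1944–1951) and §4.1 l. 1928]
[cite: Shimura1998, §6.2 Theorem 3 and §8.3 Prop. 28] -/
theorem faceSupply_of_thm418AsPrinted_liuPin
    (hHD : exists_isReal_hodgeModel) (hI : hodgePQ_independent_of_hodgeModel)
    (h₁ : BallQuotientUniformised) (h₃ : CMAbelianVarietyRealised)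
    (D : ∀ (F : CMField) (ι₁ : F →+* ℂ) (_ : HermSpace3 F ι₁) (_ : CMType F), Thm418Data (maximalRealSubfield F) F)
    (hLiu : ∀ (F : CMField), IsGalois ℚ F → 6 ≤ Module.finrank ℚ F → ∀ (Φ : CMType F) (ι₁ : F →+* ℂ), ι₁ ∈ Φ.1 →
      ∀ V : HermSpace3 F ι₁, Thm418AsPrinted (D F ι₁ V Φ))
    (hObj : ∀ (F : CMField), IsGalois ℚ F → 6 ≤ Module.finrank ℚ F → ∀ (Φ : CMType F) (ι₁ : F →+* ℂ), ι₁ ∈ Φ.1 →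
      ∀ V : HermSpace3 F ι₁, Nonempty (D F ι₁ V Φ).Obj)
    (hChi : ∀ (F : CMField), IsGalois ℚ F → 6 ≤ Module.finrank ℚ F → ∀ (Φ : CMType F) (ι₁ : F →+* ℂ), ι₁ ∈ Φ.1 →
      ∀ V : HermSpace3 F ι₁, Nonempty (D F ι₁ V Φ).Chi)
    (hirr : ∀ (F : CMField), IsGalois ℚ F → 6 ≤ Module.finrank ℚ F → ∀ (Φ : CMType F) (ι₁ : F →+* ℂ), ι₁ ∈ Φ.1 →
      ∀ (V : HermSpace3 F ι₁) (i : (D F ι₁ V Φ).AdmIndex), ((D F ι₁ V Φ).rhoAt i).IsIrreducible)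
    (hsm : ∀ (F : CMField), IsGalois ℚ F → 6 ≤ Module.finrank ℚ F → ∀ (Φ : CMType F) (ι₁ : F →+* ℂ), ι₁ ∈ Φ.1 →
      ∀ (V : HermSpace3 F ι₁) (i : (D F ι₁ V Φ).AdmIndex) (v : (D F ι₁ V Φ).omegaAt i),
        ∃ S : Subgroup (D F ι₁ V Φ).G, IsOpen (S : Set (D F ι₁ V Φ).G) ∧ ∀ k ∈ S, (D F ι₁ V Φ).rhoAt i k v = v)
    (hμ : ∀ (F : CMField), IsGalois ℚ F → 6 ≤ Module.finrank ℚ F → ∀ (Φ : CMType F) (ι₁ : F →+* ℂ), ι₁ ∈ Φ.1 →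
      ∀ (V : HermSpace3 F ι₁) (g : F ≃ₐ[ℚ] F),
        ι₁.comp (g : F →+* F) ∈ (D F ι₁ V Φ).cmType.1 ↔ ι₁.comp (g.symm : F →+* F) ∈ Φ.1)
    (hReachμ : ∀ (F : CMField) [IsGalois ℚ F], 6 ≤ Module.finrank ℚ F → ∀ (Φ : CMType F) (ι₁ : F →+* ℂ), ι₁ ∈ Φ.1 →
      ∀ V : HermSpace3 F ι₁,
        haveI := (D F ι₁ V Φ).isConjugateSymplectic.numberField_muAlgValueField
        haveI := (D F ι₁ V Φ).isConjugateSymplectic.isCMField_muAlgValueField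
        ∀ e : reflexField ℚ F (algValuedIn ι₁ (D F ι₁ V Φ).cmType.1) →+* muAlgValueField F (D F ι₁ V Φ).μ,
          (∀ k : reflexField ℚ F (algValuedIn ι₁ (D F ι₁ V Φ).cmType.1),
            ((e k : muAlgValueField F (D F ι₁ V Φ).μ) : ℂ) = ι₁ k) →
          ∃ Ksm : Subgroup (D F ι₁ V Φ).G, IsOpenCompact Ksm ∧
            ∀ (K : Subgroup (D F ι₁ V Φ).G) (Dμ : (D F ι₁ V Φ).Obj) (φ : (D F ι₁ V Φ).HomK K Dμ),
              IsOpenCompact K → K ≤ Ksm → φ ≠ 0 →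
                ∃ (Γ : Level V) (𝒥 : Jacobian (Var.scheme (ballQuotientUniformisedDatum_of h₁) h₃ (.pms (pmsCode F ι₁ V Γ))))
                  (w : 𝒥.J ⟶ (cmRealisation h₃ (cmCode (CMField.mk (muAlgValueField F (D F ι₁ V Φ).μ))
                    (inducedCMType e (reflexCMType ι₁ (D F ι₁ V Φ).cmType (AlgHom.id ℚ F))))).AV), w ≠ 0) :
    (picardCMUniverse hHD hI h₁ h₃).FaceSupply := by
  refine faceSupply_of_albaneseFactor hHD hI h₁ h₃ fun F hG h6 Φ ι₁ hι V => ?_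
  haveI := hG
  haveI := (D F ι₁ V Φ).isConjugateSymplectic.numberField_muAlgValueField
  haveI := (D F ι₁ V Φ).isConjugateSymplectic.isCMField_muAlgValueField
  obtain ⟨χ⟩ := hChi F hG h6 Φ ι₁ hι V
  obtain ⟨Dμ⟩ := hObj F hG h6 Φ ι₁ hι V
  obtain ⟨e, he⟩ := exists_liuIncl F ι₁ (D F ι₁ V Φ).cmType
    (D F ι₁ V Φ).isConjugateSymplectic (D F ι₁ V Φ).isConjugateSymplectic.hasCMType_cmType
  obtain ⟨Ksm, hKsm, hreach⟩ := hReachμ F h6 Φ ι₁ hι V e he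
  obtain ⟨K₀, hK₀, hK⟩ := Thm418Data.exists_homK_ne_zero_of_irreducible_smooth (hLiu F hG h6 Φ ι₁ hι V) Dμ χ
    (hirr F hG h6 Φ ι₁ hι V) (hsm F hG h6 Φ ι₁ hι V)
  have hKK : IsOpenCompact (K₀ ⊓ Ksm) := by
    refine ⟨?_, ?_⟩ <;> rw [Subgroup.coe_inf]
    · exact hK₀.1.inter hKsm.1
    · exact hK₀.2.inter_right (Subgroup.isClosed_of_isOpen Ksm hKsm.1)
  obtain ⟨φ, hφ⟩ := hK (K₀ ⊓ Ksm) hKK inf_le_left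
  obtain ⟨Γ, 𝒥, w, hw⟩ := hreach (K₀ ⊓ Ksm) Dμ φ hKK inf_le_right hφ
  exact ⟨Γ, 𝒥, exists_hom_cmAV_ne_zero_of_reach_cmCode_reflex h₃ F ι₁ (hμ F hG h6 Φ ι₁ hι V)
    (CMField.mk (muAlgValueField F (D F ι₁ V Φ).μ)) e hw⟩

end LiuPin

/-! ## §3  Binder-level bridges for the assembler (pin-3): `hCMμ ⟹ hCM` at any pin, and at the `E`-rational pin -/

section Bridge

/-- **BRIDGE `hCMμ ⟹ hCM` at an arbitrary pin** (for the assembler pin-3, who composes own-htheta's junction BY NAME): for the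
consumer's `D` and ANY pin `Aμ F ι₁ V Φ D_μ : AbelianVariety ℂ`, the `M_μ`-sharpened CM-side family `hCMμ` (Liu's own
`M_μ = muAlgValueField F μ`, §4.1 l. 1928, a CM number field — binder-1 p286759 —, THE inclusion `e_μ : K* → M_μ` of
`K* = ι₁⁻¹(M'_μ)`, Def. 4.3 (2) l. 1919, quantified with its defining property; only the realisation data `(ιB, θB)` of
Def. 4.5 (2) l. 1947–1949 posited) yields own-htheta's `hCM` family VERBATIM (`Item6SupplyPinned.lean`, binder `hCM`) at the same
pin: `M := M_μ`, `e := e_μ` (binder-1 `Model.exists_ringHom_reflexField_muAlgValueField`).  USE: `Model.faceSupply_of_thm418AsPrinted_pinned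
… (hCM := Model.hCM_of_hCMμ D Aμ hCMμ) …`.  HC_CM is NOT proved; `hCMμ` is not inhabited here (it IS at the Liu pin, §1).
[cite: Liu2021, Def. 4.5 (2) (FJcycle.tex l. 1944–1951), Def. 4.3 (2) (l. 1919) and §4.1 l. 1928] -/
theorem hCM_of_hCMμ
    (D : ∀ (F : CMField) (ι₁ : F →+* ℂ) (_ : HermSpace3 F ι₁) (_ : CMType F), Thm418Data (maximalRealSubfield F) F)
    (Aμ : ∀ (F : CMField) (ι₁ : F →+* ℂ) (V : HermSpace3 F ι₁) (Φ : CMType F), (D F ι₁ V Φ).Obj → AbelianVariety ℂ)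
    (hCMμ : ∀ (F : CMField) [IsGalois ℚ F], 6 ≤ Module.finrank ℚ F → ∀ (Φ : CMType F) (ι₁ : F →+* ℂ), ι₁ ∈ Φ.1 →
      ∀ (V : HermSpace3 F ι₁) (Dμ : (D F ι₁ V Φ).Obj),
        haveI := (D F ι₁ V Φ).isConjugateSymplectic.numberField_muAlgValueField
        ∀ e : reflexField ℚ F (algValuedIn ι₁ (D F ι₁ V Φ).cmType.1) →+* muAlgValueField F (D F ι₁ V Φ).μ,
          (∀ k : reflexField ℚ F (algValuedIn ι₁ (D F ι₁ V Φ).cmType.1),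
            ((e k : muAlgValueField F (D F ι₁ V Φ).μ) : ℂ) = ι₁ k) →
          ∃ (ιB : 𝓞 (muAlgValueField F (D F ι₁ V Φ).μ) →+* End (Aμ F ι₁ V Φ Dμ))
            (θB : muAlgValueField F (D F ι₁ V Φ).μ →+* Module.End ℂ (complexBetti (Aμ F ι₁ V Φ Dμ).X 1)),
            IsCMTypeRealisation (inducedCMType e (reflexCMType ι₁ (D F ι₁ V Φ).cmType (AlgHom.id ℚ F)))
              (Aμ F ι₁ V Φ Dμ) ιB θB) :
    ∀ (F : CMField) [IsGalois ℚ F], 6 ≤ Module.finrank ℚ F → ∀ (Φ : CMType F) (ι₁ : F →+* ℂ), ι₁ ∈ Φ.1 →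
      ∀ (V : HermSpace3 F ι₁) (Dμ : (D F ι₁ V Φ).Obj),
        ∃ (M : Type) (_ : Field M) (_ : NumberField M) (_ : IsCMField M)
          (e : reflexField ℚ F (algValuedIn ι₁ (D F ι₁ V Φ).cmType.1) →+* M)
          (ιB : 𝓞 M →+* End (Aμ F ι₁ V Φ Dμ)) (θB : M →+* Module.End ℂ (complexBetti (Aμ F ι₁ V Φ Dμ).X 1)),
          IsCMTypeRealisation (inducedCMType e (reflexCMType ι₁ (D F ι₁ V Φ).cmType (AlgHom.id ℚ F))) (Aμ F ι₁ V Φ Dμ) ιB θB := by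
  intro F _ h6 Φ ι₁ hι V Dμ
  haveI := (D F ι₁ V Φ).isConjugateSymplectic.numberField_muAlgValueField
  haveI := (D F ι₁ V Φ).isConjugateSymplectic.isCMField_muAlgValueField
  obtain ⟨e, he⟩ := exists_liuIncl F ι₁ (D F ι₁ V Φ).cmType
    (D F ι₁ V Φ).isConjugateSymplectic (D F ι₁ V Φ).isConjugateSymplectic.hasCMType_cmType
  obtain ⟨ιB, θB, hB⟩ := hCMμ F h6 Φ ι₁ hι V Dμ e he
  exact ⟨muAlgValueField F (D F ι₁ V Φ).μ, inferInstance, inferInstance, inferInstance, e, ιB, θB, hB⟩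

/-- **BRIDGE at the `E`-RATIONAL PIN of record** (pin-3 INTERFACE v0 §1–§2): the consumer's carrier `Aμ₀ F ι₁ V Φ D_μ : AbelianVariety F`
is Liu's «`A_μ` is an abelian variety over `E`» (Def. 4.5 (2), l. 1944; `E` = the CM field `F`), and THE PIN is its base change
`A_μ ⊗_{E,ι₁} ℂ := (Aμ₀ …).baseChange ℂ` along `ι₁` (tree `AbelianVariety.baseChange`, `Algebra F ℂ := ι₁.toAlgebra`).  The
`M_μ`-sharpened family `hCMμE` — «`A_μ ⊗_{E,ι₁} ℂ` carries an action of `𝓞_{M_μ}` (Liu's `i_μ : M_μ → End_E(A_μ)_ℚ`, Def. 4.5 (2)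
l. 1947, base-changed) realising on `H¹_B` the type `Ψ̃_μ` induced along `e_μ : K* = ι₁⁻¹(M'_μ) → M_μ` from `Φ_μ*`» (Def. 4.5 (2) first
bullet l. 1947–1949 + Def. 4.3 (2) l. 1919; tree reading `Liu2021.LiuCMData.cmType_eq_induced_of_det45`) — yields own-htheta's `hCM`
family at that pin, i.e. EXACTLY pin-3's INTERFACE v0 §2 target type.  INTEGRALITY NOTE (for the red team): Def. 4.5 (2) prints a
RATIONAL CM structure `M_μ → End_E(A_μ)_ℚ`; an action of the full ring `𝓞_{M_μ}` on `A_μ ⊗_{E,ι₁} ℂ` itself holds for the objects of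
`𝒜(μ)` whose lattice is `𝓞_{M_μ}`-stable and in general only UP TO ISOGENY — the isogeny-invariant form is §4's `hCMisog`.  HC_CM is NOT
proved; `hCMμE` is not inhabited here.
[cite: Liu2021, Def. 4.5 (2) (FJcycle.tex l. 1944–1951), Def. 4.3 (2) (l. 1919) and §4.1 l. 1928] -/
theorem hCM_of_hCMμ_baseChange
    (D : ∀ (F : CMField) (ι₁ : F →+* ℂ) (_ : HermSpace3 F ι₁) (_ : CMType F), Thm418Data (maximalRealSubfield F) F)
    (Aμ₀ : ∀ (F : CMField) (ι₁ : F →+* ℂ) (V : HermSpace3 F ι₁) (Φ : CMType F), (D F ι₁ V Φ).Obj → AbelianVariety F)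
    (hCMμE : ∀ (F : CMField) [IsGalois ℚ F], 6 ≤ Module.finrank ℚ F → ∀ (Φ : CMType F) (ι₁ : F →+* ℂ), ι₁ ∈ Φ.1 →
      ∀ (V : HermSpace3 F ι₁) (Dμ : (D F ι₁ V Φ).Obj),
        haveI := (D F ι₁ V Φ).isConjugateSymplectic.numberField_muAlgValueField
        ∀ e : reflexField ℚ F (algValuedIn ι₁ (D F ι₁ V Φ).cmType.1) →+* muAlgValueField F (D F ι₁ V Φ).μ,
          (∀ k : reflexField ℚ F (algValuedIn ι₁ (D F ι₁ V Φ).cmType.1),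
            ((e k : muAlgValueField F (D F ι₁ V Φ).μ) : ℂ) = ι₁ k) →
          ∃ (ιB : 𝓞 (muAlgValueField F (D F ι₁ V Φ).μ) →+*
                End (letI := ι₁.toAlgebra; (Aμ₀ F ι₁ V Φ Dμ).baseChange ℂ))
            (θB : muAlgValueField F (D F ι₁ V Φ).μ →+*
                Module.End ℂ (complexBetti (letI := ι₁.toAlgebra; (Aμ₀ F ι₁ V Φ Dμ).baseChange ℂ).X 1)),
            IsCMTypeRealisation (inducedCMType e (reflexCMType ι₁ (D F ι₁ V Φ).cmType (AlgHom.id ℚ F)))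
              (letI := ι₁.toAlgebra; (Aμ₀ F ι₁ V Φ Dμ).baseChange ℂ) ιB θB) :
    ∀ (F : CMField) [IsGalois ℚ F], 6 ≤ Module.finrank ℚ F → ∀ (Φ : CMType F) (ι₁ : F →+* ℂ), ι₁ ∈ Φ.1 →
      ∀ (V : HermSpace3 F ι₁) (Dμ : (D F ι₁ V Φ).Obj),
        ∃ (M : Type) (_ : Field M) (_ : NumberField M) (_ : IsCMField M)
          (e : reflexField ℚ F (algValuedIn ι₁ (D F ι₁ V Φ).cmType.1) →+* M)
          (ιB : 𝓞 M →+* End (letI := ι₁.toAlgebra; (Aμ₀ F ι₁ V Φ Dμ).baseChange ℂ))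
          (θB : M →+* Module.End ℂ (complexBetti (letI := ι₁.toAlgebra; (Aμ₀ F ι₁ V Φ Dμ).baseChange ℂ).X 1)),
          IsCMTypeRealisation (inducedCMType e (reflexCMType ι₁ (D F ι₁ V Φ).cmType (AlgHom.id ℚ F)))
            (letI := ι₁.toAlgebra; (Aμ₀ F ι₁ V Φ Dμ).baseChange ℂ) ιB θB :=
  hCM_of_hCMμ D (fun F ι₁ V Φ Dμ => (letI := ι₁.toAlgebra; (Aμ₀ F ι₁ V Φ Dμ).baseChange ℂ)) hCMμE

end Bridge

/-! ## §4  The isogeny-invariant CM side (`hCMisog`): Def. 4.5 (2) as a RATIONAL CM structure, at any pin -/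

section Isog

/-- **B01-S from [Liu 2021, Thm. 4.18] AS PRINTED at a consumer's pin, the CM side UP TO ISOGENY** (`U = picardCMUniverse hHD hI h₁ h₃`).
Same carriers and binders as own-htheta's `Model.faceSupply_of_thm418AsPrinted_pinned` (`D`, consumer pin `Aμ`, `hLiu` Thm. 4.18
l. 2232–2245, `hObj` Prop. 4.6 (1) l. 1969, `hChi` / `hirr` / `hsm` Def. 4.11 l. 2090–2096, the choice `hμ`, `hReach` §4.2 + App. C
Prop. C.5 VERBATIM at `Aμ`), except that the CM-side binder is the ISOGENY-INVARIANT reading of Def. 4.5 (2):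
* `hCMisog` — for Liu's `M_μ = muAlgValueField F μ` (l. 1928) and THE inclusion `e_μ : K* → M_μ` (Def. 4.3 (2) l. 1919; quantified with
  its defining property): `Aμ … D_μ` (intended `A_μ ⊗_{E,ι₁} ℂ`) is ISOGENOUS (`g : Aμ … D_μ ⟶ B`, `AbelianVariety.IsIsogeny g`) to a complex
  abelian variety `B` with multiplication by `𝓞_{M_μ}` realising on `H¹_B` the type `Ψ̃_μ = inducedCMType e_μ (reflexCMType ι₁ Φ_μ id)`.
  This is Def. 4.5 (2) EXACTLY AS PRINTED — «`i_μ : M_μ → End_E(A_μ)_ℚ` is a CM structure» is a RATIONAL structure (l. 1947), i.e.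
  a statement about the isogeny class, and its first bullet (l. 1947–1949, determinant of `i_μ(x)` on `Lie_E(A_μ)` = `η_μ(x)`,
  `η_μ := η'_μ ∘ Nm_{M_μ/M'_μ}` l. 1939–1942) fixes the type as `Ψ̃_μ` (tree reading `Liu2021.LiuCMData.cmType_eq_induced_of_det45`);
  an `𝓞_{M_μ}`-stable model exists in every isogeny class (Shimura 1998 §5.2) — so `hCMisog` holds for EVERY object of `𝒜(μ)`, not
  only for those with `𝓞_{M_μ}`-stable lattice (cf. §3 INTEGRALITY NOTE).
KERNEL: item6-p3 `Thm418Data.exists_homK_ne_zero_of_irreducible_smooth`, `hReach`, binder-1 `CMReach.comp_ne_zero_of_isIsogeny`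
(«isogenies kill no non-zero homomorphism», Mumford §19) and `Model.exists_hom_cmAV_ne_zero_of_isInverse_reflex` (Shimura §6 over
Riemann + §8.3 Prop. 28), item6-p1 `Model.faceSupply_of_albaneseFactor`.  No degree- or face-specific input.  HC_CM is NOT proved;
`hCMisog`, `hReach` are not inhabited here.
[cite: Liu2021, Thm. 4.18 (FJcycle.tex l. 2232–2245), Def. 4.5 (1)–(2) (l. 1939–1951), Def. 4.3 (2) (l. 1919) and §4.1 l. 1928]
[cite: Shimura1998, §5.2, §6.2 Theorem 3 and §8.3 Prop. 28] [cite: MumfordAV1970, §19 Remark p. 169] -/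
theorem faceSupply_of_thm418AsPrinted_pinned_isog
    (hHD : exists_isReal_hodgeModel) (hI : hodgePQ_independent_of_hodgeModel)
    (h₁ : BallQuotientUniformised) (h₃ : CMAbelianVarietyRealised)
    (D : ∀ (F : CMField) (ι₁ : F →+* ℂ) (_ : HermSpace3 F ι₁) (_ : CMType F), Thm418Data (maximalRealSubfield F) F)
    (Aμ : ∀ (F : CMField) (ι₁ : F →+* ℂ) (V : HermSpace3 F ι₁) (Φ : CMType F), (D F ι₁ V Φ).Obj → AbelianVariety ℂ)
    (hLiu : ∀ (F : CMField), IsGalois ℚ F → 6 ≤ Module.finrank ℚ F → ∀ (Φ : CMType F) (ι₁ : F →+* ℂ), ι₁ ∈ Φ.1 →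
      ∀ V : HermSpace3 F ι₁, Thm418AsPrinted (D F ι₁ V Φ))
    (hObj : ∀ (F : CMField), IsGalois ℚ F → 6 ≤ Module.finrank ℚ F → ∀ (Φ : CMType F) (ι₁ : F →+* ℂ), ι₁ ∈ Φ.1 →
      ∀ V : HermSpace3 F ι₁, Nonempty (D F ι₁ V Φ).Obj)
    (hChi : ∀ (F : CMField), IsGalois ℚ F → 6 ≤ Module.finrank ℚ F → ∀ (Φ : CMType F) (ι₁ : F →+* ℂ), ι₁ ∈ Φ.1 →
      ∀ V : HermSpace3 F ι₁, Nonempty (D F ι₁ V Φ).Chi)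
    (hirr : ∀ (F : CMField), IsGalois ℚ F → 6 ≤ Module.finrank ℚ F → ∀ (Φ : CMType F) (ι₁ : F →+* ℂ), ι₁ ∈ Φ.1 →
      ∀ (V : HermSpace3 F ι₁) (i : (D F ι₁ V Φ).AdmIndex), ((D F ι₁ V Φ).rhoAt i).IsIrreducible)
    (hsm : ∀ (F : CMField), IsGalois ℚ F → 6 ≤ Module.finrank ℚ F → ∀ (Φ : CMType F) (ι₁ : F →+* ℂ), ι₁ ∈ Φ.1 →
      ∀ (V : HermSpace3 F ι₁) (i : (D F ι₁ V Φ).AdmIndex) (v : (D F ι₁ V Φ).omegaAt i),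
        ∃ S : Subgroup (D F ι₁ V Φ).G, IsOpen (S : Set (D F ι₁ V Φ).G) ∧ ∀ k ∈ S, (D F ι₁ V Φ).rhoAt i k v = v)
    (hμ : ∀ (F : CMField), IsGalois ℚ F → 6 ≤ Module.finrank ℚ F → ∀ (Φ : CMType F) (ι₁ : F →+* ℂ), ι₁ ∈ Φ.1 →
      ∀ (V : HermSpace3 F ι₁) (g : F ≃ₐ[ℚ] F),
        ι₁.comp (g : F →+* F) ∈ (D F ι₁ V Φ).cmType.1 ↔ ι₁.comp (g.symm : F →+* F) ∈ Φ.1)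
    (hCMisog : ∀ (F : CMField) [IsGalois ℚ F], 6 ≤ Module.finrank ℚ F → ∀ (Φ : CMType F) (ι₁ : F →+* ℂ), ι₁ ∈ Φ.1 →
      ∀ (V : HermSpace3 F ι₁) (Dμ : (D F ι₁ V Φ).Obj),
        haveI := (D F ι₁ V Φ).isConjugateSymplectic.numberField_muAlgValueField
        ∀ e : reflexField ℚ F (algValuedIn ι₁ (D F ι₁ V Φ).cmType.1) →+* muAlgValueField F (D F ι₁ V Φ).μ,
          (∀ k : reflexField ℚ F (algValuedIn ι₁ (D F ι₁ V Φ).cmType.1),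
            ((e k : muAlgValueField F (D F ι₁ V Φ).μ) : ℂ) = ι₁ k) →
          ∃ (B : AbelianVariety ℂ) (g : Aμ F ι₁ V Φ Dμ ⟶ B), AbelianVariety.IsIsogeny g ∧
            ∃ (ιB : 𝓞 (muAlgValueField F (D F ι₁ V Φ).μ) →+* End B)
              (θB : muAlgValueField F (D F ι₁ V Φ).μ →+* Module.End ℂ (complexBetti B.X 1)),
              IsCMTypeRealisation (inducedCMType e (reflexCMType ι₁ (D F ι₁ V Φ).cmType (AlgHom.id ℚ F))) B ιB θB)
    (hReach : ∀ (F : CMField), IsGalois ℚ F → 6 ≤ Module.finrank ℚ F → ∀ (Φ : CMType F) (ι₁ : F →+* ℂ), ι₁ ∈ Φ.1 →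
      ∀ V : HermSpace3 F ι₁, ∃ Ksm : Subgroup (D F ι₁ V Φ).G, IsOpenCompact Ksm ∧
        ∀ (K : Subgroup (D F ι₁ V Φ).G) (Dμ : (D F ι₁ V Φ).Obj) (φ : (D F ι₁ V Φ).HomK K Dμ),
          IsOpenCompact K → K ≤ Ksm → φ ≠ 0 →
            ∃ (Γ : Level V) (𝒥 : Jacobian (Var.scheme (ballQuotientUniformisedDatum_of h₁) h₃ (.pms (pmsCode F ι₁ V Γ))))
              (w : 𝒥.J ⟶ Aμ F ι₁ V Φ Dμ), w ≠ 0) :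
    (picardCMUniverse hHD hI h₁ h₃).FaceSupply := by
  refine faceSupply_of_albaneseFactor hHD hI h₁ h₃ fun F hG h6 Φ ι₁ hι V => ?_
  haveI := hG
  haveI := (D F ι₁ V Φ).isConjugateSymplectic.numberField_muAlgValueField
  haveI := (D F ι₁ V Φ).isConjugateSymplectic.isCMField_muAlgValueField
  obtain ⟨χ⟩ := hChi F hG h6 Φ ι₁ hι V
  obtain ⟨Dμ⟩ := hObj F hG h6 Φ ι₁ hι V
  obtain ⟨e, he⟩ := exists_liuIncl F ι₁ (D F ι₁ V Φ).cmType
    (D F ι₁ V Φ).isConjugateSymplectic (D F ι₁ V Φ).isConjugateSymplectic.hasCMType_cmType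
  obtain ⟨Ksm, hKsm, hreach⟩ := hReach F hG h6 Φ ι₁ hι V
  obtain ⟨K₀, hK₀, hK⟩ := Thm418Data.exists_homK_ne_zero_of_irreducible_smooth (hLiu F hG h6 Φ ι₁ hι V) Dμ χ
    (hirr F hG h6 Φ ι₁ hι V) (hsm F hG h6 Φ ι₁ hι V)
  have hKK : IsOpenCompact (K₀ ⊓ Ksm) := by
    refine ⟨?_, ?_⟩ <;> rw [Subgroup.coe_inf]
    · exact hK₀.1.inter hKsm.1
    · exact hK₀.2.inter_right (Subgroup.isClosed_of_isOpen Ksm hKsm.1)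
  obtain ⟨φ, hφ⟩ := hK (K₀ ⊓ Ksm) hKK inf_le_left
  obtain ⟨Γ, 𝒥, w, hw⟩ := hreach (K₀ ⊓ Ksm) Dμ φ hKK inf_le_right hφ
  obtain ⟨B, g, hg, ιB, θB, hB⟩ := hCMisog F h6 Φ ι₁ hι V Dμ e he
  exact ⟨Γ, 𝒥, exists_hom_cmAV_ne_zero_of_isInverse_reflex h₃ F ι₁ (hμ F hG h6 Φ ι₁ hι V) e hB
    (CMReach.comp_ne_zero_of_isIsogeny hg hw)⟩

end Isog

end Summit.HodgeConjecture.CorCM.Model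

end
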